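import Literature.Analysis.Complex.JensenLaguerreFlow
import Literature.NumberTheory.LFunctions.JensenPolyaProofs
import Literature.NumberTheory.LFunctions.XiMoments
import HarnessLib

/-!
# The differentiation flow on the Jensen grid, II: inverse Rolle and the sufficiency of the flow
# invariant; the RH-EQUIVALENT `ξ` reading (all proved)

Trunk T-CA (`Literature/Analysis/Complex`), namespace `Literature.Analysis.Complex.JensenLaguerreFlow`
(continued from `JensenLaguerreFlow.lean`: shift rule `(J^{d+1,n}_γ)′ = (d+1)J^{d,n+1}_γ`, anti-diagonal
Turán determinant `D_{d+2,n} = (J^{d+1,n+1}_γ)² − J^{d+2,n}_γ·J^{d,n+2}_γ`, necessity).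

* `exists_eq_prod_of_derivative_eq_prod` — **inverse Rolle with a convexity sign condition**:
  `deg p = k+2`, `lc(p) > 0`, `p′ = c∏(X − yᵢ)` with `c > 0` and `y` strictly increasing, and
  `p(yᵢ)p″(yᵢ) < 0` at every critical point ⇒ `p = lc(p)∏(X − tⱼ)` with `t` strictly increasing
  (`k + 2` simple real zeros): the interlacing mechanism of [Szego1975, Thm. 3.3.2], via the tree's
  `exists_roots_of_alternating`, `splits_of_roots`, `sign_prod_sub` (`JensenHermite.lean`).
* `exists_eq_prod_jensenPoly_of_flowInvariant`, `splits_jensenPoly_of_flowInvariant` —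
  **sufficiency** (`FlowSufficiency` of the cell memo): for `γ > 0`, `D_{d+2,n} > 0` at the zeros of
  `J^{d+1,n+1}_γ` for every cell ⇒ every `J^{d,n}_γ = γ(n+d)∏(X − rᵢ)` with `r` strictly increasing;
  in particular all `J^{d,n}_γ` are hyperbolic — Pólya–Schur's characterisation of 𝓛𝓟 read at
  finite degree along the flow [CravenCsordas1989, §1 (i)], induction on `d`, base `J^{0,n}`, `J^{1,n}`.
* `riemannHypothesis_of_xi_flowInvariant` — the `ξ` reading, **RH-EQUIVALENT** and labelled so: the
  flow invariant at every cell of the grid of `γ = xiTaylorCoeff` (`γ > 0`: `xiTaylorCoeff_pos_holds`)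
  implies RH through the tree's `riemannHypothesis_of_jensenPolyaCriterion` [GORZPNAS2019, Thm. 1;
  Pólya 1927]; conversely RH gives `D ≥ 0` at every cell (Part I with `polya_jensen`), strictness being
  the simplicity of all Jensen zeros. It records WHICH positivity statement each unknown cell of the
  grid is; it is not evidence for or progress toward RH.

Provenance: cell rh-jensen (D-0074 GROUP I, transfer lens round 2, `LaguerreFlowSketch.lean` §2,
planner-rh-jensen-idea-1-g2-0, 2026-08-26), landed by prover-rh-jensen-eng-2-g2-0. AI-produced
formalisation; AI review is weaker than expert review. WHAT THIS IS NOT: no statement here bears on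
the truth of RH; nothing touches a crux of route-RiemannHypothesis-JensenPolynomials.

## References
* [Szego1975] G. Szegő, *Orthogonal Polynomials*, 4th ed., Thm. 3.3.2 (interlacing argument).
* [CravenCsordas1989] T. Craven, G. Csordas, Pacific J. Math. 136 (1989) 241–260, §1 (i), §2.
* [GORZPNAS2019] M. Griffin, K. Ono, L. Rolen, D. Zagier, PNAS 116 (2019) 11103–11110, §1, Thm. 1.
-/

open Polynomial Finset

namespace Literature.Analysis.Complex.JensenLaguerreFlow

open Literature.NumberTheory.LFunctions Literature.Analysis.Complex.PolyaSchur

/-! ## Sufficiency: the inverse-Rolle step -/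

/-- Sign of `∏_{b ≠ i} (yᵢ − y_b)` for a strictly increasing family `y₀ < ⋯ < y_{k}`: exactly the
`k − i` indices above `i` contribute a negative factor, so the sign is `(−1)^{k−i}`
(written `(−1)^{k+2+i}`, the convention of `Interlaces`). [folklore] -/
private theorem sign_prod_erase {k : ℕ} (y : Fin (k + 1) → ℝ) (hy : StrictMono y) (i : Fin (k + 1)) :
    0 < (-1) ^ (k + 2 + (i : ℕ)) * ∏ b ∈ univ.erase i, (y i - y b) := by
  have hset : (univ.erase i : Finset (Fin (k + 1))) = univ.image i.succAbove := by
    rw [Fin.image_succAbove_univ]; ext b; simp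
  rw [hset, Finset.prod_image (fun a _ b _ h => Fin.succAbove_right_injective h)]
  have key := sign_prod_sub (y ∘ i.succAbove) (y i) (i : ℕ) (by omega) (fun j hj => ?_)
    (fun j hj => ?_)
  · convert key using 2
    · rw [show k + 2 + (i : ℕ) = (k + (i : ℕ)) + 2 by ring, pow_add]; norm_num
    · rfl
  · have h : Fin.castSucc j < i := Fin.lt_def.mpr (by simpa using hj)
    show y (i.succAbove j) < y i
    rw [Fin.succAbove_of_castSucc_lt i j h]; exact hy h
  · have h : i ≤ Fin.castSucc j := Fin.le_def.mpr (by simpa using hj)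
    show y i < y (i.succAbove j)
    rw [Fin.succAbove_of_le_castSucc i j h]
    exact hy (Fin.lt_def.mpr (by simp [Fin.le_def] at h ⊢; omega))

/-- **Inverse Rolle with a convexity sign condition** (the interlacing mechanism of Szegő's proof
of the simplicity of the zeros of orthogonal polynomials, run for the pair `(p, p′)`): let `p` be a real
polynomial of degree `k + 2` with positive leading coefficient whose derivative is
`c · ∏_{i ≤ k} (X − yᵢ)` with `c > 0` and `y₀ < ⋯ < y_k` (so the critical points are real and simple).
If `p(yᵢ)·p″(yᵢ) < 0` at every critical point, then `p` has `k + 2` simple real zeros,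
`p = lc(p) · ∏ (X − tⱼ)` with `t₀ < ⋯ < t_{k+1}`: the values `p(yᵢ)` alternate in sign (because the
`p″(yᵢ)` do), and `p → ±∞` appropriately at `±∞`; then the intermediate value theorem.
[cite: Szego1975, Theorem 3.3.2 (proof: interlacing from sign alternation)] -/
theorem exists_eq_prod_of_derivative_eq_prod {p : ℝ[X]} {k : ℕ} (hdeg : p.natDegree = k + 2)
    (hlc : 0 < p.leadingCoeff) {c : ℝ} (hc : 0 < c) {y : Fin (k + 1) → ℝ} (hy : StrictMono y)
    (hder : derivative p = C c * ∏ i, (X - C (y i)))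
    (hsign : ∀ i, p.eval (y i) * (derivative (derivative p)).eval (y i) < 0) :
    ∃ t : Fin (k + 2) → ℝ, StrictMono t ∧ p = C p.leadingCoeff * ∏ i, (X - C (t i)) := by
  have hp0 : p ≠ 0 := by
    intro h; rw [h, leadingCoeff_zero] at hlc; exact lt_irrefl _ hlc
  -- the second derivative at the critical points
  have hd2 : derivative (derivative p) = C c * ∑ a, ∏ b ∈ univ.erase a, (X - C (y b)) := by
    rw [hder, derivative_C_mul, derivative_prod_finset]
    simp only [derivative_sub, derivative_X, derivative_C, sub_zero, mul_one]
  have hev : ∀ i, (derivative (derivative p)).eval (y i) = c * ∏ b ∈ univ.erase i, (y i - y b) := by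
    intro i
    rw [hd2, eval_mul, eval_C, eval_finsetSum, Finset.sum_eq_single i]
    · simp [eval_prod]
    · intro a _ ha
      rw [eval_prod]
      exact Finset.prod_eq_zero (Finset.mem_erase.mpr ⟨Ne.symm ha, Finset.mem_univ i⟩) (by simp)
    · intro hi; exact absurd (Finset.mem_univ i) hi
  -- hence `p(yᵢ)` alternates: `0 < (−1)^{k+1+i} p(yᵢ)` (positive sign convention at the top index
  -- for `−p″`, i.e. `p(y_k) < 0`)
  have hpy : ∀ i : Fin (k + 1), 0 < (-1) ^ (k + 1 + (i : ℕ)) * p.eval (y i) := by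
    intro i
    have h1 : 0 < (-1) ^ (k + 2 + (i : ℕ)) * (derivative (derivative p)).eval (y i) := by
      rw [hev, mul_left_comm]
      exact mul_pos hc (sign_prod_erase y hy i)
    have h2 := hsign i
    have hsq : ((-1 : ℝ)) ^ (k + 2 + (i : ℕ)) = -((-1) ^ (k + 1 + (i : ℕ))) := by
      rw [show k + 2 + (i : ℕ) = (k + 1 + (i : ℕ)) + 1 by ring, pow_succ]; ring
    have hone : ((-1 : ℝ)) ^ (k + 1 + (i : ℕ)) * (-1) ^ (k + 1 + (i : ℕ)) = 1 := by
      rw [← pow_add, ← two_mul]; exact (even_two_mul _).neg_one_pow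
    rw [hsq] at h1
    nlinarith [h1, h2, hone, sq_nonneg (p.eval (y i)), sq_nonneg ((derivative (derivative p)).eval (y i))]
  -- behaviour at `+∞`
  obtain ⟨shi, hshi_gt, hshi_pos⟩ : ∃ s, y (Fin.last k) < s ∧ 0 < p.eval s := by
    have ht : Filter.Tendsto (fun x => p.eval x) Filter.atTop Filter.atTop :=
      p.tendsto_atTop_of_leadingCoeff_nonneg
        (by rw [degree_eq_natDegree hp0, hdeg]; exact_mod_cast Nat.succ_pos _) hlc.le
    exact ((ht.eventually_gt_atTop 0).and (Filter.eventually_gt_atTop _)).exists.imp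
      fun s hs => ⟨hs.2, hs.1⟩
  -- behaviour at `−∞`
  obtain ⟨slo, hslo_lt, hslo_pos⟩ : ∃ s, s < y 0 ∧ 0 < (-1) ^ (k + 2) * p.eval s := by
    set S := C ((-1 : ℝ) ^ (k + 2)) * p.comp (-X) with hS
    have hSlead : S.leadingCoeff = p.leadingCoeff := by
      rw [hS, leadingCoeff_mul, leadingCoeff_C, comp_neg_X_leadingCoeff_eq, hdeg, ← mul_assoc,
        ← pow_add, ← two_mul, (even_two_mul _).neg_one_pow, one_mul]
    have hSdeg : S.natDegree = k + 2 := by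
      rw [hS, natDegree_C_mul (pow_ne_zero _ (by norm_num)), natDegree_comp, hdeg]; simp
    have hSne : S ≠ 0 := by
      intro h0; rw [h0, leadingCoeff_zero] at hSlead; rw [← hSlead] at hlc; exact lt_irrefl _ hlc
    have ht : Filter.Tendsto (fun x => S.eval x) Filter.atTop Filter.atTop :=
      S.tendsto_atTop_of_leadingCoeff_nonneg
        (by rw [degree_eq_natDegree hSne, hSdeg]; exact_mod_cast Nat.succ_pos _)
        (by rw [hSlead]; exact hlc.le)
    obtain ⟨x, hx1, hx2⟩ :=
      ((ht.eventually_gt_atTop 0).and (Filter.eventually_gt_atTop (-y 0))).exists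
    refine ⟨-x, by linarith, ?_⟩
    simpa [hS] using hx1
  -- the test points `slo, y₀, …, y_k, shi`
  let u : Fin (k + 3) → ℝ := fun j =>
    if h0 : (j : ℕ) = 0 then slo else if h1 : (j : ℕ) ≤ k + 1 then y ⟨(j : ℕ) - 1, by omega⟩ else shi
  have hu0 : u 0 = slo := by simp [u]
  have humid : ∀ i : Fin (k + 1), u ⟨(i : ℕ) + 1, by omega⟩ = y i := by
    intro i
    simp only [u, Nat.add_one_ne_zero, ↓reduceDIte]
    rw [dif_pos (by omega)]
    congr 1
  have hulast : u (Fin.last (k + 2)) = shi := by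
    simp only [u, Fin.val_last]
    rw [dif_neg (by omega), dif_neg (by omega)]
  -- signs at the test points: `0 < (−1)^{k+2+j} p(u_j)`
  have hpu : ∀ j : Fin (k + 3), 0 < (-1) ^ (k + 2 + (j : ℕ)) * p.eval (u j) := by
    intro j
    by_cases h0 : (j : ℕ) = 0
    · have : j = 0 := Fin.ext h0
      subst this
      simpa [hu0] using hslo_pos
    · by_cases h1 : (j : ℕ) ≤ k + 1
      · have hj : u j = y ⟨(j : ℕ) - 1, by omega⟩ := by
          have := humid ⟨(j : ℕ) - 1, by omega⟩
          convert this using 2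
          ext; simp; omega
        rw [hj]
        have hs := hpy ⟨(j : ℕ) - 1, by omega⟩
        have hpow : ((-1 : ℝ)) ^ (k + 2 + (j : ℕ)) = (-1) ^ (k + 1 + ((j : ℕ) - 1)) := by
          rw [show k + 2 + (j : ℕ) = (k + 1 + ((j : ℕ) - 1)) + 2 by omega, pow_add]; norm_num
        rw [hpow]; exact hs
      · have : j = Fin.last (k + 2) := Fin.ext (by simp; omega)
        subst this
        rw [hulast]
        have hpow : ((-1 : ℝ)) ^ (k + 2 + ((Fin.last (k + 2) : Fin (k + 3)) : ℕ)) = 1 := by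
          rw [Fin.val_last, ← two_mul]; exact (even_two_mul _).neg_one_pow
        rw [hpow, one_mul]; exact hshi_pos
  -- strict monotonicity of `u`
  have humono : StrictMono u := by
    rw [Fin.strictMono_iff_lt_succ]
    intro j
    by_cases h0 : (j : ℕ) = 0
    · have e1 : u j.castSucc = slo := by
        simp only [u]; rw [dif_pos (by simpa using h0)]
      have e2 : u j.succ = y 0 := by
        simp only [u, Fin.val_succ, Nat.add_one_ne_zero, ↓reduceDIte]
        rw [dif_pos (by omega)]; exact congrArg y (Fin.ext (by simp [h0]))
      rw [e1, e2]; exact hslo_lt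
    · by_cases h1 : (j : ℕ) + 1 ≤ k + 1
      · have e1 : u j.castSucc = y ⟨(j : ℕ) - 1, by omega⟩ := by
          simp only [u, Fin.val_castSucc, h0, ↓reduceDIte]; rw [dif_pos (by omega)]
        have e2 : u j.succ = y ⟨(j : ℕ), by omega⟩ := by
          simp only [u, Fin.val_succ, Nat.add_one_ne_zero, ↓reduceDIte]
          rw [dif_pos (by omega)]; exact congrArg y (Fin.ext (by simp))
        rw [e1, e2]; exact hy (Fin.mk_lt_mk.mpr (by omega))
      · have e1 : u j.castSucc = y (Fin.last k) := by
          simp only [u, Fin.val_castSucc, h0, ↓reduceDIte]; rw [dif_pos (by omega)]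
          exact congrArg y (Fin.ext (by simp; omega))
        have e2 : u j.succ = shi := by
          simp only [u, Fin.val_succ, Nat.add_one_ne_zero, ↓reduceDIte]; rw [dif_neg (by omega)]
        rw [e1, e2]; exact hshi_gt
  -- alternation
  have halt : ∀ j : Fin (k + 2), p.eval (u j.castSucc) * p.eval (u j.succ) < 0 := by
    intro j
    have h1 := hpu j.castSucc
    have h2 := hpu j.succ
    have hpow : ((-1 : ℝ)) ^ (k + 2 + (j.succ : ℕ)) = -(-1) ^ (k + 2 + (j.castSucc : ℕ)) := by
      rw [Fin.val_succ, Fin.val_castSucc, ← add_assoc, pow_succ]; ring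
    rw [hpow] at h2
    have hsq : ((-1 : ℝ)) ^ (k + 2 + (j.castSucc : ℕ)) * (-1) ^ (k + 2 + (j.castSucc : ℕ)) = 1 := by
      rw [← pow_add, ← two_mul]; exact (even_two_mul _).neg_one_pow
    nlinarith [mul_pos h1 h2]
  -- the roots
  obtain ⟨t, htmono, -, htroot⟩ := exists_roots_of_alternating p u humono halt
  obtain ⟨hsplits, -, hroots⟩ := splits_of_roots hp0 hdeg.le t htmono.injective htroot
  refine ⟨t, htmono, ?_⟩
  conv_lhs => rw [hsplits.eq_prod_roots]
  rw [hroots, Multiset.map_map]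
  rfl

/-! ## Sufficiency: the flow invariant at every cell forces hyperbolicity of the whole grid -/

/-- Leading coefficient of `J^{d,n}_γ`: `γ(n + d)` (when it is nonzero). [cite: GORZPNAS2019, §1] -/
theorem leadingCoeff_jensenPoly (γ : ℕ → ℝ) (d n : ℕ) (h : γ (n + d) ≠ 0) :
    (jensenPoly γ d n).leadingCoeff = γ (n + d) := by
  rw [leadingCoeff, natDegree_jensenPoly γ d n h, coeff_jensenPoly]; simp

/-- **Sufficiency of the flow invariant (inverse Rolle along the anti-diagonals).** Let `γ > 0` and
suppose that at EVERY cell `(d+2, n)` of the Jensen grid the anti-diagonal Turán determinant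
`D_{d+2,n} = (J^{d+1,n+1}_γ)² − J^{d+2,n}_γ·J^{d,n+2}_γ` is positive at every real zero of
`J^{d+1,n+1}_γ` (equivalently `J^{d+2,n}_γ · J^{d,n+2}_γ < 0` there, i.e. `p·p″ < 0` at the critical
points of `p = J^{d+2,n}_γ`, by the shift rule). Then every `J^{d,n}_γ` has `d` SIMPLE real zeros:
`J^{d,n}_γ = γ(n+d)·∏_{i<d}(X − rᵢ)` with `r₀ < ⋯ < r_{d-1}`. Induction on `d` along the flow
`(J^{d+2,n})′ = (d+2)·J^{d+1,n+1}`, the step being `exists_eq_prod_of_derivative_eq_prod`; the base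
`J^{1,n}_γ = γ(n) + γ(n+1)X` is always hyperbolic. This is the finite-degree («degree-aware») form of
the Laguerre-inequality reading of the Laguerre–Pólya class. [cite: CravenCsordas1989, §1 (i)
(Jensen polynomials of 𝓛𝓟 functions; Pólya–Schur)] [cite: Szego1975, Theorem 3.3.2 (interlacing)] -/
theorem exists_eq_prod_jensenPoly_of_flowInvariant {γ : ℕ → ℝ} (hpos : ∀ m, 0 < γ m)
    (hinv : ∀ d n (y : ℝ), (jensenPoly γ (d + 1) (n + 1)).IsRoot y →
      0 < (jensenPoly γ (d + 1) (n + 1) ^ 2 - jensenPoly γ (d + 2) n * jensenPoly γ d (n + 2)).eval y)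
    (d n : ℕ) :
    ∃ r : Fin d → ℝ, StrictMono r ∧ jensenPoly γ d n = C (γ (n + d)) * ∏ i, (X - C (r i)) := by
  induction d using Nat.twoStepInduction generalizing n with
  | zero =>
    refine ⟨fun i => i.elim0, fun i => i.elim0, ?_⟩
    simp [jensenPoly]
  | one =>
    refine ⟨fun _ => -(γ n / γ (n + 1)), fun a b hab => absurd (Subsingleton.elim a b) hab.ne, ?_⟩
    have hne : γ (n + 1) ≠ 0 := (hpos _).ne'
    rw [Fin.prod_univ_one, mul_sub, ← C_mul,
      show γ (n + 1) * -(γ n / γ (n + 1)) = -γ n by field_simp, C_neg]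
    simp [jensenPoly, Finset.sum_range_succ]
    ring
  | more d _ ih =>
    obtain ⟨y, hy, hJ⟩ := ih (n + 1)
    have hne : γ (n + (d + 2)) ≠ 0 := (hpos _).ne'
    have hdeg : (jensenPoly γ (d + 2) n).natDegree = d + 2 := natDegree_jensenPoly γ (d + 2) n hne
    have hlcp : (jensenPoly γ (d + 2) n).leadingCoeff = γ (n + (d + 2)) :=
      leadingCoeff_jensenPoly γ (d + 2) n hne
    have hlc : 0 < (jensenPoly γ (d + 2) n).leadingCoeff := by rw [hlcp]; exact hpos _
    have hc : 0 < (((d + 1 : ℕ) : ℝ) + 1) * γ (n + 1 + (d + 1)) := by positivity [hpos (n + 1 + (d + 1))]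
    have hder : derivative (jensenPoly γ (d + 2) n) =
        C ((((d + 1 : ℕ) : ℝ) + 1) * γ (n + 1 + (d + 1))) * ∏ i, (X - C (y i)) := by
      rw [show d + 2 = d + 1 + 1 from rfl, derivative_jensenPoly_succ, hJ, ← mul_assoc, ← C_mul]
    have hsign : ∀ i, (jensenPoly γ (d + 2) n).eval (y i) *
        (derivative (derivative (jensenPoly γ (d + 2) n))).eval (y i) < 0 := by
      intro i
      have hroot0 : (jensenPoly γ (d + 1) (n + 1)).eval (y i) = 0 := by
        rw [hJ, eval_mul, eval_prod]
        exact mul_eq_zero_of_right _ (Finset.prod_eq_zero (Finset.mem_univ i) (by simp))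
      have hi := hinv d n (y i) hroot0
      simp only [eval_sub, eval_mul, eval_pow, hroot0] at hi
      have hneg : (jensenPoly γ (d + 2) n).eval (y i) * (jensenPoly γ d (n + 2)).eval (y i) < 0 := by
        nlinarith [hi]
      have hpos' : (0 : ℝ) < ((d : ℝ) + 2) * ((d : ℝ) + 1) := by positivity
      rw [eval_derivative_derivative_jensenPoly_add_two]
      calc (jensenPoly γ (d + 2) n).eval (y i) *
            (((d : ℝ) + 2) * ((d : ℝ) + 1) * (jensenPoly γ d (n + 2)).eval (y i))
          = (((d : ℝ) + 2) * ((d : ℝ) + 1)) *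
              ((jensenPoly γ (d + 2) n).eval (y i) * (jensenPoly γ d (n + 2)).eval (y i)) := by ring
        _ < 0 := mul_neg_of_pos_of_neg hpos' hneg
    obtain ⟨t, ht, hp⟩ := exists_eq_prod_of_derivative_eq_prod hdeg hlc hc hy hder hsign
    exact ⟨t, ht, by rw [hlcp] at hp; exact hp⟩

/-- **Corollary (`FlowSufficiency`).** For a positive sequence `γ`, the flow invariant at every cell
implies that every Jensen polynomial `J^{d,n}_γ` is hyperbolic. [cite: CravenCsordas1989, §1 (i)
(Jensen polynomials of 𝓛𝓟 functions; Pólya–Schur)] -/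
theorem splits_jensenPoly_of_flowInvariant {γ : ℕ → ℝ} (hpos : ∀ m, 0 < γ m)
    (hinv : ∀ d n (y : ℝ), (jensenPoly γ (d + 1) (n + 1)).IsRoot y →
      0 < (jensenPoly γ (d + 1) (n + 1) ^ 2 - jensenPoly γ (d + 2) n * jensenPoly γ d (n + 2)).eval y)
    (d n : ℕ) : (jensenPoly γ d n).Splits := by
  obtain ⟨r, -, h⟩ := exists_eq_prod_jensenPoly_of_flowInvariant hpos hinv d n
  rw [h]
  exact (Splits.C _).mul (Splits.prod fun i _ => Splits.X_sub_C _)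

/-! ## The `ξ` reading (RH-EQUIVALENT, for the record) -/

/-- **The Laguerre-flow criterion for `Ξ` implies RH** (RH-EQUIVALENT statement, recorded as the
target the flow dictionary pins; no new information about RH): if at every cell of the Jensen grid
of `γ = xiTaylorCoeff` (`γ > 0`, `xiTaylorCoeff_pos_holds`) the anti-diagonal Turán determinant is
positive at the zeros of `J^{d+1,n+1}_γ`, then every `J^{d,n}_γ` is hyperbolic
(`splits_jensenPoly_of_flowInvariant`), hence RH by Pólya's criterion
(`riemannHypothesis_of_jensenPolyaCriterion`). Conversely RH gives the non-strict invariant at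
every cell (`eval_antiTuranDet_nonneg_of_splits` with `polya_jensen`); strictness is the simplicity
of all Jensen zeros. [cite: GORZPNAS2019, Theorem 1 (RH ⇔ hyperbolicity of all J^{d,n}_γ; Pólya 1927)]
[cite: CravenCsordas1989, §1 (i)] -/
theorem riemannHypothesis_of_xi_flowInvariant
    (hinv : ∀ d n (y : ℝ), (jensenPoly xiTaylorCoeff (d + 1) (n + 1)).IsRoot y →
      0 < (jensenPoly xiTaylorCoeff (d + 1) (n + 1) ^ 2 -
        jensenPoly xiTaylorCoeff (d + 2) n * jensenPoly xiTaylorCoeff d (n + 2)).eval y) :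
    RiemannHypothesis :=
  riemannHypothesis_of_jensenPolyaCriterion fun d n =>
    splits_jensenPoly_of_flowInvariant xiTaylorCoeff_pos_holds hinv d n

end Literature.Analysis.Complex.JensenLaguerreFlow
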